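import Summits.KontsevichZagierPeriods.KontsevichZagierPeriods.Theorems.ValuedFieldSpecialisationCTConstructionSplitTyped

/-!
# Route ValuedFieldSpecialisation — crux `CTConstruction`: the weight-slab blow-up is the sheared blow-up

Helper toward crux stmt-KontsevichZagierPeriods-3495 (`CTConstruction`), line `registered`,
reshape r4 (blow-up elimination of the log block), stub `stub_blowup_shear`. A family is an
`(n+1)`-dimensional integral representation `ρ` read over the parameter `s = z 0`. Its
**weight-slab blow-up** `βʷρ` (coordinates `z = (σ, t, x)`) has domain
`{z | 0 < z 1 < z 0 < 1, tail z ∈ ρ.domain}` and integrand `(z 1 / z 0 ^ 2) · ρ.integrand (tail z)`;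
its **sheared blow-up** `β₁ρ` (coordinates `z = (σ, s', x)`, the point fed to `ρ` being `(σ s', x)`)
has domain `{z | 0 < z 0 < 1, 0 < z 1 < 1, tail (Ψ z) ∈ ρ.domain}` and integrand
`z 1 · ρ.integrand (tail (Ψ z))`, where `Ψ z = update z 1 (z 1 * z 0)` is the fibred shear
`t = σ s'` (a polynomial map fixing `z 0`, Jacobian `z 0`).

`stub_blowup_shear`: given `βʷρ = ρ'`, the sheared blow-up `ρ₁` EXISTS and
`[ρ'] - [ρ₁] ∈ KZ.fibredRelations`. It is constructed by transport of structure through `Ψ`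
(`exists_rep_of_sub_mem_fibredRelations_shear_of_eq`, the two-integrand form of
`exists_rep_of_sub_mem_fibredRelations_shear` of the companion file
`…CTConstructionSplitTyped.lean`: preimage of a semialgebraic set under a polynomial map,
composite of a semialgebraic function with a polynomial map,
`MeasureTheory.integrableOn_image_iff_integrableOn_abs_det_fderiv_smul`, and the fibred change of
variables `KZ.of_sub_of_mem_fibredChangeOfVariablesRel`), the integrand identity being
`((z 1 z 0) / z 0 ^ 2) · z 0 = z 1`, and the preimage of the weight slab `{0 < t < σ < 1}` being the
square `{0 < σ < 1, 0 < s' < 1}`.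

Sources: M. Kontsevich, D. Zagier, *Periods* (2001), §1.2 (rule (2)); J. Bochnak, M. Coste,
M.-F. Roy, *Real Algebraic Geometry* (1998), §2.2 (Prop. 2.2.6, semialgebraic maps). No new
definitions.
-/

noncomputable section

namespace Summit.KontsevichZagierPeriods.ValuedFieldSpecialisation

open MeasureTheory Set Filter
open scoped Topology
open Literature.NumberTheory.Transcendental Literature.NumberTheory.Transcendental.KZ
open Literature.ModelTheory.ExponentialFields (IsSemialgebraic)

/-- **Transport through the shear, two-integrand form.** Let `R'` be a representation in dimension
`N + 1` on whose domain `0 < z 0`, let `i ≠ 0`, `Ψ z = update z i (z i * z 0)` the shear, and let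
`f` satisfy `f z = R'.integrand (Ψ z) * z 0` on the preimage `E = Ψ ⁻¹' R'.domain`. Then `E` carries
a representation `R''` with integrand `f`, and `[R'] - [R''] ∈ fibredRelations`: `Ψ` is a fibred
change of variables from `R''` onto `R'` (polynomial, injective on `{0 < z 0}`, `Ψ z 0 = z 0`,
Jacobian `z 0 > 0`, `shear_data`), and `R''` is integrable by the change-of-variables formula.
[Kontsevich–Zagier 2001, §1.2 rule (2)] [folklore] -/
theorem exists_rep_of_sub_mem_fibredRelations_shear_of_eq {N : ℕ} (i : Fin (N + 1)) (hi : i ≠ 0)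
    (R' : IntegralRep (N + 1)) (f : (Fin (N + 1) → ℝ) → ℝ) (hpos : ∀ z ∈ R'.domain, 0 < z 0)
    (hf : ∀ z : Fin (N + 1) → ℝ, Function.update z i (z i * z 0) ∈ R'.domain →
      f z = R'.integrand (Function.update z i (z i * z 0)) * z 0)
    {E : Set (Fin (N + 1) → ℝ)} (hE : E = {z | Function.update z i (z i * z 0) ∈ R'.domain}) :
    ∃ R'' : IntegralRep (N + 1), R''.domain = E ∧ R''.integrand = f ∧
      of R' - of R'' ∈ fibredRelations := by
  subst hE
  obtain ⟨Φ', hderiv, hdet⟩ := shear_data i hi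
  set D : Set (Fin (N + 1) → ℝ) := {z | Function.update z i (z i * z 0) ∈ R'.domain}
  have hsa : IsSemialgebraic ℚ D := isSemialgebraic_setOf_shear_mem R'.isSemialgebraic_domain i
  have hmeas : MeasurableSet D := IsSemialgebraic.measurableSet_holds hsa
  have h0 : ∀ z : Fin (N + 1) → ℝ, Function.update z i (z i * z 0) 0 = z 0 := fun z =>
    Function.update_of_ne hi.symm _ _
  have hposD : ∀ z ∈ D, 0 < z 0 := fun z hz => h0 z ▸ hpos (Function.update z i (z i * z 0)) hz
  -- `Ψ` is injective on `D` and maps `D` onto `R'.domain`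
  have hinj : InjOn (fun z : Fin (N + 1) → ℝ => Function.update z i (z i * z 0)) D := by
    intro z₁ _ z₂ hz₂ h
    have h0' : z₁ 0 = z₂ 0 := by simpa only [h0] using congrFun h 0
    refine funext fun k => ?_
    rcases eq_or_ne k i with rfl | hk
    · refine mul_right_cancel₀ (hposD _ hz₂).ne' ?_
      simpa only [Function.update_self, h0'] using congrFun h k
    · simpa only [Function.update_of_ne hk] using congrFun h k
  have himg : (fun z : Fin (N + 1) → ℝ => Function.update z i (z i * z 0)) '' D = R'.domain := by
    refine subset_antisymm (image_subset_iff.mpr fun z hz => hz) fun y hy => ?_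
    have hback : Function.update (Function.update y i (y i / y 0)) i
        (Function.update y i (y i / y 0) i * Function.update y i (y i / y 0) 0) = y := by
      rw [Function.update_self, Function.update_of_ne hi.symm, Function.update_idem,
        div_mul_cancel₀ _ (hpos y hy).ne', Function.update_eq_self]
    refine ⟨Function.update y i (y i / y 0), ?_, hback⟩
    show Function.update (Function.update y i (y i / y 0)) i _ ∈ R'.domain
    rw [hback]
    exact hy
  -- the transported integrand is semialgebraic and integrable on `D`
  have hfi : IsSemialgebraicFunOn ℚ D f := by
    refine (IsSemialgebraicFunOn.mul_holds (IsSemialgebraicFunOn.comp_isSemialgebraicMapOn_holds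
      R'.isSemialgebraicFunOn_integrand (isSemialgebraicMapOn_shear hsa i) fun z hz => hz)
      (isSemialgebraicFunOn_apply hsa (0 : Fin (N + 1)))).congr fun z hz => ?_
    rw [Pi.mul_apply, Function.comp_apply]
    exact (hf z hz).symm
  have hint : IntegrableOn f D volume := by
    refine ((integrableOn_image_iff_integrableOn_abs_det_fderiv_smul volume hmeas
      (fun x _ => (hderiv x).hasFDerivWithinAt) hinj R'.integrand).mp
        (by rw [himg]; exact R'.integrableOn)).congr_fun (fun z hz => ?_) hmeas
    dsimp only
    rw [smul_eq_mul, hdet, abs_of_pos (hposD z hz), mul_comm]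
    exact (hf z hz).symm
  refine ⟨⟨D, f, hsa, hfi, hint⟩, rfl, rfl, ?_⟩
  -- `Ψ` is a fibred change of variables from `R''` onto `R'`
  have hcov : of (⟨D, f, hsa, hfi, hint⟩ : IntegralRep (N + 1)) - of R' ∈
      fibredChangeOfVariablesRel :=
    of_sub_of_mem_fibredChangeOfVariablesRel
      (Φ := fun z : Fin (N + 1) → ℝ => Function.update z i (z i * z 0)) (Φ' := Φ')
      (isSemialgebraicMapOn_shear hsa i) (fun x _ => (hderiv x).hasFDerivWithinAt) hinj himg.symm
      (fun x hx => by
        dsimp only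
        rw [hdet, abs_of_pos (hposD x hx)]
        exact hf x hx)
      (fun x _ => h0 x)
  simpa only [neg_sub] using
    fibredRelations.neg_mem (mem_fibredRelations_of_mem_fibredChangeOfVariablesRel hcov)

/-- **Stub `stub_blowup_shear` (the weight-slab blow-up is fibred-equivalent to the sheared
blow-up).** Given the weight-slab blow-up `ρ'` of a family `ρ` (domain
`{z | 0 < z 1 < z 0 < 1, tail z ∈ ρ.domain}`, integrand `(z 1 / z 0 ^ 2) ρ.integrand (tail z)`),
the sheared blow-up `ρ₁` — domain `{z | 0 < z 0 < 1, 0 < z 1 < 1, tail (Ψ z) ∈ ρ.domain}`,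
integrand `z 1 · ρ.integrand (tail (Ψ z))`, `Ψ z = update z 1 (z 1 * z 0)` the fibred shear
`t = σ s'` — exists and `[ρ'] - [ρ₁] ∈ KZ.fibredRelations`: transport of structure through `Ψ`
(`exists_rep_of_sub_mem_fibredRelations_shear_of_eq`), with the integrand identity
`((z 1 z 0) / z 0 ^ 2) ρ.integrand (tail (Ψ z)) · z 0 = z 1 ρ.integrand (tail (Ψ z))` and the
preimage of the slab `{0 < t < σ < 1}` under `Ψ` being `{0 < σ < 1} × {0 < s' < 1}`.
[Kontsevich–Zagier 2001, §1.2 rule (2)] [folklore] -/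
theorem stub_blowup_shear : ∀ (n : ℕ) (ρ : Literature.NumberTheory.Transcendental.KZ.IntegralRep (n + 1)) (ρ' : Literature.NumberTheory.Transcendental.KZ.IntegralRep (n + 1 + 1)), ρ'.domain = {z | 0 < z 1 ∧ z 1 < z 0 ∧ z 0 < 1 ∧ (fun i : Fin (n + 1) => z i.succ) ∈ ρ.domain} → ρ'.integrand = (fun z => z 1 / z 0 ^ 2 * ρ.integrand (fun i : Fin (n + 1) => z i.succ)) → ∃ ρ₁ : Literature.NumberTheory.Transcendental.KZ.IntegralRep (n + 1 + 1), ρ₁.domain = {z | 0 < z 0 ∧ z 0 < 1 ∧ 0 < z 1 ∧ z 1 < 1 ∧ (fun i : Fin (n + 1) => (Function.update z 1 (z 1 * z 0) i.succ : ℝ)) ∈ ρ.domain} ∧ ρ₁.integrand = (fun z => z 1 * ρ.integrand (fun i : Fin (n + 1) => (Function.update z 1 (z 1 * z 0) i.succ : ℝ))) ∧ Literature.NumberTheory.Transcendental.KZ.of ρ' - Literature.NumberTheory.Transcendental.KZ.of ρ₁ ∈ Literature.NumberTheory.Transcendental.KZ.fibredRelations := by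
  intro n ρ ρ' hd hi
  have h10 : (1 : Fin (n + 1 + 1)) ≠ 0 := (Fin.zero_lt_one (n := n)).ne'
  have h0 : ∀ z : Fin (n + 1 + 1) → ℝ, Function.update z 1 (z 1 * z 0) 0 = z 0 := fun z =>
    Function.update_of_ne h10.symm _ _
  have hpos : ∀ z ∈ ρ'.domain, 0 < z 0 := fun z hz => by
    rw [hd] at hz
    exact hz.1.trans hz.2.1
  refine exists_rep_of_sub_mem_fibredRelations_shear_of_eq 1 h10 ρ' _ hpos (fun z hz => ?_) ?_
  · -- the integrand identity `z 1 · F = ((z 1 z 0) / z 0 ^ 2) · F · z 0`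
    have hz0 : z 0 ≠ 0 := (h0 z ▸ hpos _ hz).ne'
    rw [hi]
    dsimp only
    rw [h0, Function.update_self]
    field_simp
  · -- the preimage of the weight slab under the shear is the square
    ext z
    simp only [hd, mem_setOf_eq, h0, Function.update_self]
    constructor
    · rintro ⟨hz0, hz01, hz1, hz11, hmem⟩
      exact ⟨mul_pos hz1 hz0, mul_lt_of_lt_one_left hz0 hz11, hz01, hmem⟩
    · rintro ⟨h1, h2, hz01, hmem⟩
      have hz0 : 0 < z 0 := h1.trans h2
      exact ⟨hz0, hz01, pos_of_mul_pos_left h1 hz0.le,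
        lt_of_mul_lt_mul_right (h2.trans_eq (one_mul (z 0)).symm) hz0.le, hmem⟩

end Summit.KontsevichZagierPeriods.ValuedFieldSpecialisation
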